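import Mathlib
import HarnessLib
import Literature.MathematicalPhysics.KineticTheory.VelocityFlipNoise
import Literature.MathematicalPhysics.KineticTheory.LangevinChainGibbs

/-!
# Stub A4 `stub_fixedAbelThermodynamicLimit` (line `abel-storage-decay`, crux `VanishingNoiseTransfer.NoisyFourier`,
# stmt-AtomisticToContinuum-11977): the TIME-DOMAIN re-routing — A4 from a fixed-time profile of the pairing

`--supports stmt-AtomisticToContinuum-11977` file (worker A4 of lead c6), companion of
`…NoisyFourierFixedAbelTLOfBulkRowHomogeneity` (A4 ⇐ bulk ROW homogeneity). Setting: the flip-noisy pinned chain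
`𝐏 = pinnedChain ω₂ lam β γ`, Gibbs measure `μ_T = 𝐏.gibbsMeasure L T`, classical Abel correctors `u_{L,s}`
(`L_ε u = s u − J_L`, `J_L = Σ_i j_i`), pairing `σ_L(s) = ∫ J_L u_{L,s} dμ_T`; A4 asks that `σ_L(s)/(L − 1)` converge
as `L → ∞` at fixed `s ∈ (0,1]`.

Why a second reduction. Row-wise bulk homogeneity needs, for EACH deep row `⟨j_i, u_{L,s}⟩ = ∫₀^∞ e^{-st}⟨j_i, V_t J_L⟩dt`
(`V_t` the flip semigroup), a large-time bound uniform in `L`, and only `‖j_i‖‖J_L‖ = O(√L)` is free; the `L`-SUMMED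
profile `c_L(t) = ⟨J_L, V_t J_L⟩_{μ_T}` instead obeys `|c_L(t)| ≤ ‖J_L‖² = O(L − 1)` for free (contraction + invariance),
so dominated convergence in `t` needs locality at FIXED times only — the architecture of the landed deterministic twin
(`…LatticeLandauDampingAbelThermodynamicLimitFixedFrequencyMatchingOfFixedTime`). This file lands that glue for the
flip chain with the profile kept ABSTRACT (the tree's flip semigroup `VanishingNoiseBound.exists_flipSemigroup` is
existential), so that the open content of A4 splits into
(T1) [fixed `L`, semigroup theory] a TIME-PROFILE REPRESENTATION `σ_L(s) = ∫₀^∞ e^{-st} c_L(t) dt` with `c_L` measurable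
and `|c_L(t)| ≤ B(L − 1)`, and (T2) [thermodynamic limit, locality] `c_L(t)/(L − 1) → C(t)` for a.e. `t > 0`:

* `TimeProfile.tendsto_div_of_timeProfile` — the real-analysis core: (T1) + (T2) for abstract `σ, c, C, B` give
  `σ_L/(L − 1) → ∫₀^∞ e^{-st} C(t) dt` (dominated convergence against `|B| e^{-st}`; no measurability of `C` needed);
* `helper_fixedAbelTLOfTimeProfile` (registered) — if every family of classical Abel correctors at `s ∈ (0,1]` admits
  such a profile, the registered signature of `stub_fixedAbelThermodynamicLimit` holds verbatim.

References: folklore (Laplace transform, dominated convergence). No definitions; axioms `propext`, `Classical.choice`,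
`Quot.sound` only.
-/

noncomputable section

open MeasureTheory Filter Topology Set
open scoped BigOperators
open Literature.MathematicalPhysics.KineticTheory.HeatConduction

namespace Summit.AtomisticToContinuum.FouriersLaw.Cruxes.NoisyFourier.AbelKapitzaEvenCorrector

namespace TimeProfile

/-- **Dominated convergence for Laplace-represented sequences.** If `σ_L = ∫₀^∞ e^{-st} c_L(t) dt` for `L ≥ 2` with
`c_L` measurable, `|c_L(t)| ≤ B(L − 1)` for `t > 0`, and `c_L(t)/(L − 1) → C(t)` for a.e. `t > 0`, then
`σ_L/(L − 1) → ∫₀^∞ e^{-st} C(t) dt` (`s > 0`). [folklore] -/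
theorem tendsto_div_of_timeProfile {s : ℝ} (hs : 0 < s) {σ : ℕ → ℝ} {c : ℕ → ℝ → ℝ} {C : ℝ → ℝ} {B : ℝ}
    (hcm : ∀ L : ℕ, Measurable (c L))
    (hcb : ∀ L : ℕ, 2 ≤ L → ∀ t : ℝ, 0 < t → |c L t| ≤ B * ((L : ℝ) - 1))
    (hlim : ∀ᵐ t ∂(volume.restrict (Ioi (0 : ℝ))),
      Tendsto (fun L : ℕ => c L t / ((L : ℝ) - 1)) atTop (𝓝 (C t)))
    (hrep : ∀ L : ℕ, 2 ≤ L → σ L = ∫ t in Ioi (0 : ℝ), Real.exp (-(s * t)) * c L t) :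
    Tendsto (fun L : ℕ => σ L / ((L : ℝ) - 1)) atTop
      (𝓝 (∫ t in Ioi (0 : ℝ), Real.exp (-(s * t)) * C t)) := by
  -- adapted from `tendsto_laplace_totalCurrentAutocorr_div_of_ae_tendsto`
  -- (…LatticeLandauDampingAbelThermodynamicLimitFixedFrequencyMatchingOfFixedTime): abstract profile, bound only for `L ≥ 2`
  have key : Tendsto (fun L : ℕ => ∫ t in Ioi (0 : ℝ), Real.exp (-(s * t)) * c L t / ((L : ℝ) - 1)) atTop
      (𝓝 (∫ t in Ioi (0 : ℝ), Real.exp (-(s * t)) * C t)) := by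
    refine tendsto_integral_filter_of_dominated_convergence (fun t => |B| * Real.exp (-s * t)) ?_ ?_ ?_ ?_
    · exact Eventually.of_forall fun L =>
        (((by fun_prop : Measurable fun t : ℝ => Real.exp (-(s * t))).mul (hcm L)).div_const
          ((L : ℝ) - 1)).aestronglyMeasurable
    · filter_upwards [eventually_ge_atTop 2] with L hL
      refine (ae_restrict_iff' measurableSet_Ioi).2 (ae_of_all _ fun t ht => ?_)
      have hL1 : 0 < (L : ℝ) - 1 := by
        have : (2 : ℝ) ≤ L := by exact_mod_cast hL
        linarith
      have hct : |c L t| / ((L : ℝ) - 1) ≤ |B| := by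
        rw [div_le_iff₀ hL1]
        exact (hcb L hL t ht).trans (mul_le_mul_of_nonneg_right (le_abs_self B) hL1.le)
      rw [Real.norm_eq_abs, mul_div_assoc, abs_mul, Real.abs_exp, neg_mul, mul_comm |B|, abs_div,
        abs_of_pos hL1]
      exact mul_le_mul_of_nonneg_left hct (Real.exp_pos _).le
    · exact (exp_neg_integrableOn_Ioi 0 hs).const_mul |B|
    · filter_upwards [hlim] with t ht
      simpa only [mul_div_assoc] using ht.const_mul (Real.exp (-(s * t)))
  refine key.congr' ?_
  filter_upwards [eventually_ge_atTop 2] with L hL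
  rw [hrep L hL, integral_div]

end TimeProfile

/-! ## Registered helper -/

/-- Registered helper sub-goal `helper_fixedAbelTLOfTimeProfile` of stub `stub_fixedAbelThermodynamicLimit` (line
`abel-storage-decay`, crux stmt-AtomisticToContinuum-11977): **A4 ⇐ TIME-PROFILE REPRESENTATION + FIXED-TIME MATCHING.**
If for all parameters, every `s ∈ (0,1]` and every family `u` of classical Abel correctors the pairings
`σ_L(s) = ∫ J_L u_L dμ_{L,T}` are Laplace transforms `∫₀^∞ e^{-st} c_L(t) dt` (`L ≥ 2`) of measurable profiles with
`|c_L(t)| ≤ B(L − 1)` (T1: for the flip semigroup `V_t`, `c_L(t) = ⟨J_L, V_t J_L⟩_{μ_T}`, free by contraction and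
invariance) such that `c_L(t)/(L − 1)` converges for a.e. `t > 0` (T2: light cone of the flip dynamics at fixed time +
bulk window equivalence), then the registered signature of `stub_fixedAbelThermodynamicLimit` holds verbatim, with
`K = ∫₀^∞ e^{-st} C(t) dt` (`TimeProfile.tendsto_div_of_timeProfile`). [folklore] -/
theorem helper_fixedAbelTLOfTimeProfile : (∀ (ω₂ lam β γ T ε : ℝ), 0 < ω₂ → 0 < lam → 0 < β → 0 < γ → 0 < T → 0 < ε → ∀ s : ℝ, 0 < s → s ≤ 1 → ∀ u : (L : ℕ) → Literature.MathematicalPhysics.KineticTheory.HeatConduction.PhaseSpace L → ℝ, (∀ L : ℕ, 2 ≤ L → ContDiff ℝ 2 (u L) ∧ MeasureTheory.MemLp (u L) 2 ((Literature.MathematicalPhysics.KineticTheory.HeatConduction.pinnedChain ω₂ lam β γ).gibbsMeasure L T) ∧ ∀ x, (Literature.MathematicalPhysics.KineticTheory.HeatConduction.pinnedChain ω₂ lam β γ).flipGenerator L T T ε (u L) x = s * u L x - ∑ i : Fin L, (Literature.MathematicalPhysics.KineticTheory.HeatConduction.pinnedChain ω₂ lam β γ).bondCurrent L i x) → ∃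 c : ℕ → ℝ → ℝ, ∃ C : ℝ → ℝ, ∃ B : ℝ, (∀ L : ℕ, Measurable (c L)) ∧ (∀ L : ℕ, 2 ≤ L → ∀ t : ℝ, 0 < t → |c L t| ≤ B * ((L : ℝ) - 1)) ∧ (Filter.Eventually (fun t : ℝ => Filter.Tendsto (fun L : ℕ => c L t / ((L : ℝ) - 1)) Filter.atTop (nhds (C t))) (MeasureTheory.ae (MeasureTheory.volume.restrict (Set.Ioi (0 : ℝ))))) ∧ ∀ L : ℕ, 2 ≤ L → MeasureTheory.integral ((Literature.MathematicalPhysics.KineticTheory.HeatConduction.pinnedChain ω₂ lam β γ).gibbsMeasure L T) (fun x => (∑ i : Fin L, (Literature.MathematicalPhysics.KineticTheory.HeatConduction.pinnedChain ω₂ lam β γ).bondCurrent L i x) * u L x) = MeasureTheory.integral (MeasureTheory.volume.restrict (Set.Ioi (0 : ℝ))) (fun t => Real.exp (-(s * t)) * c L t)) → ∀ (ω₂ lam β γ T ε : ℝ), 0 < ω₂ → 0 < lam → 0 < β → 0 < γ → 0 < T → 0 < ε → ∀ s : ℝ, 0 < s → s ≤ 1 → ∀ u : (L : ℕ) → Literature.MathematicalPhysics.KineticTheory.HeatConduction.PhaseSpace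 L → ℝ, (∀ L : ℕ, 2 ≤ L → ContDiff ℝ 2 (u L) ∧ MeasureTheory.MemLp (u L) 2 ((Literature.MathematicalPhysics.KineticTheory.HeatConduction.pinnedChain ω₂ lam β γ).gibbsMeasure L T) ∧ ∀ x, (Literature.MathematicalPhysics.KineticTheory.HeatConduction.pinnedChain ω₂ lam β γ).flipGenerator L T T ε (u L) x = s * u L x - ∑ i : Fin L, (Literature.MathematicalPhysics.KineticTheory.HeatConduction.pinnedChain ω₂ lam β γ).bondCurrent L i x) → ∃ K : ℝ, Filter.Tendsto (fun L : ℕ => (MeasureTheory.integral ((Literature.MathematicalPhysics.KineticTheory.HeatConduction.pinnedChain ω₂ lam β γ).gibbsMeasure L T) (fun x => (∑ i : Fin L, (Literature.MathematicalPhysics.KineticTheory.HeatConduction.pinnedChain ω₂ lam β γ).bondCurrent L i x) * u L x)) / ((L : ℝ) - 1)) Filter.atTop (nhds K) := by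
  intro hX ω₂ lam β γ T ε hω hl hβ hγ hT hε s hs hs1 u hu
  obtain ⟨c, C, B, hcm, hcb, hlim, hrep⟩ := hX ω₂ lam β γ T ε hω hl hβ hγ hT hε s hs hs1 u hu
  exact ⟨_, TimeProfile.tendsto_div_of_timeProfile hs hcm hcb hlim hrep⟩

end Summit.AtomisticToContinuum.FouriersLaw.Cruxes.NoisyFourier.AbelKapitzaEvenCorrector

end
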